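import Summits.NavierStokesRegularity.NavierStokesRegularity.Theorems.FilamentSkeletonRssDefectColumnGateVorticityForm

/-!
# Route `FilamentSkeletonRss` · ∀-crux `TransverseReduction1AR` (stmt-NavierStokesRegularity-23611) / support 23920 — NEGATIVE-side groundwork:
# the LAGRANGE (GREEN) IDENTITY for the steady vorticity-transport operator in rotating similarity variables

Helper file (theorems only), `--supports stmt-NavierStokesRegularity-23611 --as helper`; LEAD of 23611 / registrar of 23920, lane ns-filament-21221-p1 g14.

WHY.  The daylight successor candidate B2′ «NoExactProfileNearGappedSkeleton» (tenure g27 Q-day-1, LEAD 03:40Z) rests on an EXACT per-basin identity: for an exact steady profile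
`U` (vorticity `Ω = curl U`, `curl E_α(U) = 𝒯_U Ω = 0` by `curl_lerayOp_of_isDivFree`) and ANY test field `Ψ`,
  `⟪Ψ, 𝒯_U Ω⟫ − ⟪𝒯_U^* Ψ, Ω⟫ = div J(Ψ, Ω)`  POINTWISE,
with `𝒯_U Ω = α𝓡Ω + Ω + ½DΩ[y] − ΔΩ + DΩ[U] − DU[Ω]`, the formal adjoint `𝒯_U^*Ψ = −α𝓡Ψ − ½Ψ − ½DΨ[y] − ΔΨ − DΨ[U] − (DU)†Ψ`, and the current
`J = ⟪Ψ,Ω⟫·v + Σ_i (⟪∂_iΨ, Ω⟫ − ⟪Ψ, ∂_iΩ⟫) e_i`, `v = U + ½y − α e₃×y` the frame field (`div v = 3/2` for solenoidal `U`).  Integrated over a basin against an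
adjoint solution `𝒯_U^*Ψ = 0` it says: boundary flux of `J` = `Σ_k B_k ⟪Ψ, curl D_k⟫` for a solution modulo accretion modes, `= 0` for an exact profile — the «leak − feed»
budget is an exact boundary integral, no asymptotics (LD-b).  This file proves the pointwise identity; the integration and the sign (LD-a) are not here.
HONEST FRAMING: calculus bookkeeping on the NEGATIVE side of a HYPOTHETICAL filament-type rotating-self-similar blow-up route (MODEL rung); no item is proved or refuted;
23611/23920 OPEN; nothing here bears on Navier–Stokes regularity, which is NOT proved.
-/

set_option linter.dupNamespace false

noncomputable section

namespace Summit.NavierStokesRegularity.NavierStokesRegularity.Theorems.DefectColumnGate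

open scoped BigOperators Topology InnerProductSpace Laplacian ContDiff
open Set Function
open Literature.Analysis.FluidPDE
open Summit.NavierStokesRegularity.NavierStokesRegularity.Theorems.KelvinGate

/-! ## Small algebra -/

/-- The standard basis is orthonormal: `⟪e_i, e_k⟫ = [i = k]`. -/
theorem inner_basisFun_basisFun (i k : Fin 3) :
    ⟪EuclideanSpace.basisFun (Fin 3) ℝ i, EuclideanSpace.basisFun (Fin 3) ℝ k⟫_ℝ = if i = k then 1 else 0 :=
  orthonormal_iff_ite.mp (EuclideanSpace.basisFun (Fin 3) ℝ).orthonormal i k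

/-- `Σ_i ⟪e_i, e₃ × e_i⟫ = 0` (the rotation generator is trace-free). -/
theorem sum_inner_basisFun_rotGen :
    ∑ i : Fin 3, ⟪EuclideanSpace.basisFun (Fin 3) ℝ i, rotGen (EuclideanSpace.basisFun (Fin 3) ℝ i)⟫_ℝ = 0 := by
  refine Finset.sum_eq_zero fun i _ => ?_
  rw [real_inner_comm, inner_rotGen_self]

/-- `Σ_i ⟪e_i, L e_i⟫` is the divergence's trace: for the identity it is `3`. -/
theorem sum_inner_basisFun_self : ∑ i : Fin 3, ⟪EuclideanSpace.basisFun (Fin 3) ℝ i, EuclideanSpace.basisFun (Fin 3) ℝ i⟫_ℝ = 3 := by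
  simp only [inner_basisFun_basisFun, if_true, Finset.sum_const, Finset.card_univ, Fintype.card_fin]
  norm_num

/-! ## The Lagrange identity -/

/-- **LAGRANGE (GREEN) IDENTITY for the steady vorticity-transport operator, pointwise.**  For `U, Ω, Ψ ∈ C²` with `div U = 0`, at every `y`:
`⟪Ψ, 𝒯_U Ω⟫ − ⟪𝒯_U^*Ψ, Ω⟫ = div J`, where
`𝒯_U Ω = α(e₃×Ω − DΩ[e₃×y]) + Ω + ½DΩ[y] − ΔΩ + DΩ[U] − DU[Ω]` (the vorticity form `curl ∘ E_α`, cf. `curl_lerayOp_of_isDivFree`),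
`𝒯_U^*Ψ = −α(e₃×Ψ − DΨ[e₃×y]) − ½Ψ − ½DΨ[y] − ΔΨ − DΨ[U] − (DU)†Ψ`,
`J = ⟪Ψ,Ω⟫·(U + ½y − α e₃×y) + Σ_i (⟪DΨ[e_i], Ω⟫ − ⟪Ψ, DΩ[e_i]⟫)·e_i`. -/
theorem vorticity_lagrange_identity (α : ℝ) {U Ω Ψ : EuclideanSpace ℝ (Fin 3) → EuclideanSpace ℝ (Fin 3)}
    (hU : ContDiff ℝ 2 U) (hΩ : ContDiff ℝ 2 Ω) (hΨ : ContDiff ℝ 2 Ψ) (hdiv : VectorCalculus.IsDivFree U) (y : EuclideanSpace ℝ (Fin 3)) :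
    ⟪Ψ y, α • (cross (EuclideanSpace.single 2 1) (Ω y) - fderiv ℝ Ω y (cross (EuclideanSpace.single 2 1) y)) + Ω y + (1/2:ℝ) • fderiv ℝ Ω y y
        - (Δ Ω) y + fderiv ℝ Ω y (U y) - fderiv ℝ U y (Ω y)⟫_ℝ
      - ⟪-(α • (cross (EuclideanSpace.single 2 1) (Ψ y) - fderiv ℝ Ψ y (cross (EuclideanSpace.single 2 1) y))) - (1/2:ℝ) • Ψ y - (1/2:ℝ) • fderiv ℝ Ψ y y
        - (Δ Ψ) y - fderiv ℝ Ψ y (U y) - ContinuousLinearMap.adjoint (fderiv ℝ U y) (Ψ y), Ω y⟫_ℝ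
    = VectorCalculus.divergence (fun z => ⟪Ψ z, Ω z⟫_ℝ • (U z + (1/2:ℝ) • z - α • cross (EuclideanSpace.single 2 1) z)
        + ∑ i : Fin 3, (⟪fderiv ℝ Ψ z (EuclideanSpace.basisFun (Fin 3) ℝ i), Ω z⟫_ℝ - ⟪Ψ z, fderiv ℝ Ω z (EuclideanSpace.basisFun (Fin 3) ℝ i)⟫_ℝ)
          • EuclideanSpace.basisFun (Fin 3) ℝ i) y := by
  have hΨ1 : Differentiable ℝ Ψ := hΨ.differentiable (by norm_num)
  have hΩ1 : Differentiable ℝ Ω := hΩ.differentiable (by norm_num)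
  have hU1 : Differentiable ℝ U := hU.differentiable (by norm_num)
  have hDΨ : Differentiable ℝ (fderiv ℝ Ψ) := (hΨ.fderiv_right (m := 1) (by norm_num)).differentiable (by norm_num)
  have hDΩ : Differentiable ℝ (fderiv ℝ Ω) := (hΩ.fderiv_right (m := 1) (by norm_num)).differentiable (by norm_num)
  -- the scalar `f = ⟪Ψ, Ω⟫` and its derivative
  have hf : DifferentiableAt ℝ (fun z => ⟪Ψ z, Ω z⟫_ℝ) y := (hΨ1 y).inner ℝ (hΩ1 y)
  have hfD : ∀ h, fderiv ℝ (fun z => ⟪Ψ z, Ω z⟫_ℝ) y h = ⟪Ψ y, fderiv ℝ Ω y h⟫_ℝ + ⟪fderiv ℝ Ψ y h, Ω y⟫_ℝ :=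
    fun h => fderiv_inner_apply ℝ (hΨ1 y) (hΩ1 y) h
  -- the frame field and its divergence `3/2`
  have hdv : HasFDerivAt (fun z => U z + (1/2:ℝ) • z - α • cross (EuclideanSpace.single 2 1) z)
      (fderiv ℝ U y + (1/2:ℝ) • ContinuousLinearMap.id ℝ _ - α • rotGenL) y := by
    have h : HasFDerivAt (fun z => U z + (1/2:ℝ) • z - α • rotGenL z)
        (fderiv ℝ U y + (1/2:ℝ) • ContinuousLinearMap.id ℝ _ - α • rotGenL) y :=
      ((hU1 y).hasFDerivAt.add ((hasFDerivAt_id y).const_smul (1/2:ℝ))).sub ((rotGenL.hasFDerivAt (x := y)).const_smul α)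
    have e : (fun z => U z + (1/2:ℝ) • z - α • cross (EuclideanSpace.single 2 1) z) = fun z => U z + (1/2:ℝ) • z - α • rotGenL z := by
      funext z; rw [cross_single_two_eq_rotGenL]
    rw [e]; exact h
  have hv : DifferentiableAt ℝ (fun z => U z + (1/2:ℝ) • z - α • cross (EuclideanSpace.single 2 1) z) y := hdv.differentiableAt
  have hdivv : VectorCalculus.divergence (fun z => U z + (1/2:ℝ) • z - α • cross (EuclideanSpace.single 2 1) z) y = 3 / 2 := by
    rw [divergence_eq_sum_inner_fderiv (EuclideanSpace.basisFun (Fin 3) ℝ), hdv.fderiv]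
    simp only [FunLike.coe_sub, Pi.sub_apply, FunLike.coe_add, Pi.add_apply, FunLike.coe_smul, Pi.smul_apply, ContinuousLinearMap.id_apply, rotGenL_apply,
      inner_sub_right, inner_add_right, real_inner_smul_right, Finset.sum_sub_distrib, Finset.sum_add_distrib, ← Finset.mul_sum,
      sum_inner_basisFun_rotGen, sum_inner_basisFun_self]
    have h0 : ∑ i : Fin 3, ⟪EuclideanSpace.basisFun (Fin 3) ℝ i, fderiv ℝ U y (EuclideanSpace.basisFun (Fin 3) ℝ i)⟫_ℝ = 0 := by
      rw [← divergence_eq_sum_inner_fderiv]; exact hdiv y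
    rw [h0]; ring
  -- divergence of the transport part of the current
  have hdiv1 : VectorCalculus.divergence (fun z => ⟪Ψ z, Ω z⟫_ℝ • (U z + (1/2:ℝ) • z - α • cross (EuclideanSpace.single 2 1) z)) y =
      ⟪Ψ y, Ω y⟫_ℝ * (3 / 2) + (⟪Ψ y, fderiv ℝ Ω y (U y + (1/2:ℝ) • y - α • cross (EuclideanSpace.single 2 1) y)⟫_ℝ +
        ⟪fderiv ℝ Ψ y (U y + (1/2:ℝ) • y - α • cross (EuclideanSpace.single 2 1) y), Ω y⟫_ℝ) := by
    -- Leibniz rule `div(f·T) = f·div T + Df[T]` (as in the tree's `divergence_smul_pt`, inlined to keep imports light)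
    have hd : HasFDerivAt (fun z => ⟪Ψ z, Ω z⟫_ℝ • (U z + (1/2:ℝ) • z - α • cross (EuclideanSpace.single 2 1) z))
        (⟪Ψ y, Ω y⟫_ℝ • fderiv ℝ (fun z => U z + (1/2:ℝ) • z - α • cross (EuclideanSpace.single 2 1) z) y +
          (fderiv ℝ (fun z => ⟪Ψ z, Ω z⟫_ℝ) y).smulRight (U y + (1/2:ℝ) • y - α • cross (EuclideanSpace.single 2 1) y)) y :=
      hf.hasFDerivAt.smul hv.hasFDerivAt
    have hlin : ∑ i : Fin 3, fderiv ℝ (fun z => ⟪Ψ z, Ω z⟫_ℝ) y (EuclideanSpace.basisFun (Fin 3) ℝ i) *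
        ⟪EuclideanSpace.basisFun (Fin 3) ℝ i, U y + (1/2:ℝ) • y - α • cross (EuclideanSpace.single 2 1) y⟫_ℝ =
        fderiv ℝ (fun z => ⟪Ψ z, Ω z⟫_ℝ) y (U y + (1/2:ℝ) • y - α • cross (EuclideanSpace.single 2 1) y) := by
      have hT' : U y + (1/2:ℝ) • y - α • cross (EuclideanSpace.single 2 1) y =
          ∑ i : Fin 3, ⟪EuclideanSpace.basisFun (Fin 3) ℝ i, U y + (1/2:ℝ) • y - α • cross (EuclideanSpace.single 2 1) y⟫_ℝ •
            EuclideanSpace.basisFun (Fin 3) ℝ i :=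
        ((EuclideanSpace.basisFun (Fin 3) ℝ).sum_repr' _).symm
      conv_rhs => rw [hT', map_sum]
      refine Finset.sum_congr rfl fun i _ => ?_
      rw [map_smul, smul_eq_mul, mul_comm]
    rw [divergence_eq_sum_inner_fderiv (EuclideanSpace.basisFun (Fin 3) ℝ), hd.fderiv]
    simp only [FunLike.coe_add, Pi.add_apply, FunLike.coe_smul, Pi.smul_apply, ContinuousLinearMap.smulRight_apply, inner_add_right,
      real_inner_smul_right, Finset.sum_add_distrib, ← Finset.mul_sum, ← divergence_eq_sum_inner_fderiv, hdivv]
    rw [hlin, hfD]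
  -- the diffusion part of the current: `g_i = ⟪DΨ e_i, Ω⟫ − ⟪Ψ, DΩ e_i⟫`
  have hgd : ∀ i, DifferentiableAt ℝ (fun z => ⟪fderiv ℝ Ψ z (EuclideanSpace.basisFun (Fin 3) ℝ i), Ω z⟫_ℝ - ⟪Ψ z, fderiv ℝ Ω z (EuclideanSpace.basisFun (Fin 3) ℝ i)⟫_ℝ) y := fun i =>
    (((hDΨ y).clm_apply (differentiableAt_const _)).inner ℝ (hΩ1 y)).sub ((hΨ1 y).inner ℝ ((hDΩ y).clm_apply (differentiableAt_const _)))
  have hgD : ∀ i, fderiv ℝ (fun z => ⟪fderiv ℝ Ψ z (EuclideanSpace.basisFun (Fin 3) ℝ i), Ω z⟫_ℝ - ⟪Ψ z, fderiv ℝ Ω z (EuclideanSpace.basisFun (Fin 3) ℝ i)⟫_ℝ) y (EuclideanSpace.basisFun (Fin 3) ℝ i) =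
      ⟪fderiv ℝ (fderiv ℝ Ψ) y (EuclideanSpace.basisFun (Fin 3) ℝ i) (EuclideanSpace.basisFun (Fin 3) ℝ i), Ω y⟫_ℝ - ⟪Ψ y, fderiv ℝ (fderiv ℝ Ω) y (EuclideanSpace.basisFun (Fin 3) ℝ i) (EuclideanSpace.basisFun (Fin 3) ℝ i)⟫_ℝ := by
    intro i
    have h1 : DifferentiableAt ℝ (fun z => fderiv ℝ Ψ z (EuclideanSpace.basisFun (Fin 3) ℝ i)) y := (hDΨ y).clm_apply (differentiableAt_const _)
    have h2 : DifferentiableAt ℝ (fun z => fderiv ℝ Ω z (EuclideanSpace.basisFun (Fin 3) ℝ i)) y := (hDΩ y).clm_apply (differentiableAt_const _)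
    rw [fderiv_fun_sub (h1.inner ℝ (hΩ1 y)) ((hΨ1 y).inner ℝ h2), FunLike.coe_sub, Pi.sub_apply,
      fderiv_inner_apply ℝ h1 (hΩ1 y), fderiv_inner_apply ℝ (hΨ1 y) h2,
      fderiv_clm_apply (hDΨ y) (differentiableAt_const _), fderiv_clm_apply (hDΩ y) (differentiableAt_const _)]
    simp only [fderiv_fun_const, Pi.zero_apply, FunLike.coe_zero, FunLike.coe_add, Pi.add_apply, ContinuousLinearMap.comp_apply,
      map_zero, zero_add, ContinuousLinearMap.flip_apply]
    -- cross terms `⟪DΨ e_i, DΩ e_i⟫` cancel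
    rw [real_inner_comm (fderiv ℝ Ω y (EuclideanSpace.basisFun (Fin 3) ℝ i)) (fderiv ℝ Ψ y (EuclideanSpace.basisFun (Fin 3) ℝ i))]
    ring
  have hdiv2 : VectorCalculus.divergence (fun z => ∑ i : Fin 3, (⟪fderiv ℝ Ψ z (EuclideanSpace.basisFun (Fin 3) ℝ i), Ω z⟫_ℝ - ⟪Ψ z, fderiv ℝ Ω z (EuclideanSpace.basisFun (Fin 3) ℝ i)⟫_ℝ) • EuclideanSpace.basisFun (Fin 3) ℝ i) y =
      ⟪(Δ Ψ) y, Ω y⟫_ℝ - ⟪Ψ y, (Δ Ω) y⟫_ℝ := by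
    have hd : HasFDerivAt (fun z => ∑ i : Fin 3, (⟪fderiv ℝ Ψ z (EuclideanSpace.basisFun (Fin 3) ℝ i), Ω z⟫_ℝ - ⟪Ψ z, fderiv ℝ Ω z (EuclideanSpace.basisFun (Fin 3) ℝ i)⟫_ℝ) • EuclideanSpace.basisFun (Fin 3) ℝ i)
        (∑ i : Fin 3, (fderiv ℝ (fun z => ⟪fderiv ℝ Ψ z (EuclideanSpace.basisFun (Fin 3) ℝ i), Ω z⟫_ℝ - ⟪Ψ z, fderiv ℝ Ω z (EuclideanSpace.basisFun (Fin 3) ℝ i)⟫_ℝ) y).smulRight (EuclideanSpace.basisFun (Fin 3) ℝ i)) y :=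
      HasFDerivAt.fun_sum fun i _ => (hgd i).hasFDerivAt.smul_const (EuclideanSpace.basisFun (Fin 3) ℝ i)
    rw [divergence_eq_sum_inner_fderiv (EuclideanSpace.basisFun (Fin 3) ℝ), hd.fderiv]
    simp only [FunLike.coe_sum, Finset.sum_apply, ContinuousLinearMap.smulRight_apply, inner_sum, real_inner_smul_right]
    -- orthonormality collapses the double sum
    have hcol : ∀ i : Fin 3, ∑ k : Fin 3, fderiv ℝ (fun z => ⟪fderiv ℝ Ψ z (EuclideanSpace.basisFun (Fin 3) ℝ k), Ω z⟫_ℝ - ⟪Ψ z, fderiv ℝ Ω z (EuclideanSpace.basisFun (Fin 3) ℝ k)⟫_ℝ) y (EuclideanSpace.basisFun (Fin 3) ℝ i) *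
        ⟪EuclideanSpace.basisFun (Fin 3) ℝ i, EuclideanSpace.basisFun (Fin 3) ℝ k⟫_ℝ =
        fderiv ℝ (fun z => ⟪fderiv ℝ Ψ z (EuclideanSpace.basisFun (Fin 3) ℝ i), Ω z⟫_ℝ - ⟪Ψ z, fderiv ℝ Ω z (EuclideanSpace.basisFun (Fin 3) ℝ i)⟫_ℝ) y (EuclideanSpace.basisFun (Fin 3) ℝ i) := by
      intro i
      simp only [inner_basisFun_basisFun, mul_ite, mul_one, mul_zero, Finset.sum_ite_eq, Finset.mem_univ, if_true]
    simp only [hcol, hgD, Finset.sum_sub_distrib]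
    rw [laplacian_eq_sum_fderiv_fderiv Ψ, laplacian_eq_sum_fderiv_fderiv Ω]
    simp only [sum_inner, inner_sum]
  -- the divergence of the full current
  have hJ : VectorCalculus.divergence (fun z => ⟪Ψ z, Ω z⟫_ℝ • (U z + (1/2:ℝ) • z - α • cross (EuclideanSpace.single 2 1) z)
        + ∑ i : Fin 3, (⟪fderiv ℝ Ψ z (EuclideanSpace.basisFun (Fin 3) ℝ i), Ω z⟫_ℝ - ⟪Ψ z, fderiv ℝ Ω z (EuclideanSpace.basisFun (Fin 3) ℝ i)⟫_ℝ)
          • EuclideanSpace.basisFun (Fin 3) ℝ i) y =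
      (⟪Ψ y, Ω y⟫_ℝ * (3 / 2) + (⟪Ψ y, fderiv ℝ Ω y (U y + (1/2:ℝ) • y - α • cross (EuclideanSpace.single 2 1) y)⟫_ℝ +
        ⟪fderiv ℝ Ψ y (U y + (1/2:ℝ) • y - α • cross (EuclideanSpace.single 2 1) y), Ω y⟫_ℝ)) + (⟪(Δ Ψ) y, Ω y⟫_ℝ - ⟪Ψ y, (Δ Ω) y⟫_ℝ) := by
    have hs : DifferentiableAt ℝ (fun z => ∑ i : Fin 3, (⟪fderiv ℝ Ψ z (EuclideanSpace.basisFun (Fin 3) ℝ i), Ω z⟫_ℝ - ⟪Ψ z, fderiv ℝ Ω z (EuclideanSpace.basisFun (Fin 3) ℝ i)⟫_ℝ) • EuclideanSpace.basisFun (Fin 3) ℝ i) y :=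
      DifferentiableAt.fun_sum fun i _ => (hgd i).smul_const (EuclideanSpace.basisFun (Fin 3) ℝ i)
    rw [← hdiv1, ← hdiv2]
    unfold VectorCalculus.divergence
    rw [fderiv_fun_add (hf.fun_smul hv) hs, ContinuousLinearMap.toLinearMap_add, map_add]
  rw [hJ]
  -- the left side: expand, use skewness of `e₃ ×` and the adjoint
  simp only [cross_single_two_eq_rotGenL, inner_add_left, inner_sub_left, inner_neg_left, inner_smul_left, inner_add_right, inner_sub_right,
    inner_smul_right, map_add, map_sub, map_smul, RCLike.conj_to_real, ContinuousLinearMap.adjoint_inner_left]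
  simp only [rotGenL_apply]
  rw [show ⟪Ψ y, rotGen (Ω y)⟫_ℝ = -⟪rotGen (Ψ y), Ω y⟫_ℝ by rw [real_inner_comm, inner_rotGen_left, inner_rotGen_left]; ring]
  ring

end Summit.NavierStokesRegularity.NavierStokesRegularity.Theorems.DefectColumnGate

end
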